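import Mathlib.Analysis.Asymptotics.Lemmas
import Literature.Computability.AlgebraicComplexity.RectangularExponentBounds
import HarnessLib

/-!
# Convexity of the rectangular exponent `k ↦ ω(1, k, 1)` — proved

Topic `Literature/Computability/AlgebraicComplexity`. Discharge of the named fact
`omegaRect_convexOn_middle` of `RectangularExponent.lean`
(`∀ K field, ConvexOn ℝ [0, ∞) (k ↦ ω(1, k, 1))`), i.e. the convexity of the rectangular matrix
multiplication exponent in the rectangular dimension: Lotti–Romani 1983, §1 (p. 173: from
`B(x + x', y + y', z + z') ≤ B(x, y, z) + B(x', y', z')` and `B(νx, νy, νz) = ν B(x, y, z)`, "hence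
`B(x, y, z)` is a continuous and convex function") and §2 (p. 174: "`f(x) = B(x, 1, 1)` is a
continuous and convex function"); this is the convexity invoked in Le Gall 2012, §1 ("exploit the
convexity of the function `ω(1,1,k)`", whence his interpolation
`ω(1,1,k) ≤ ω(1,1,k₀) + (ω − ω(1,1,k₀))(k − k₀)/(1 − k₀)`, already derived from the fact as
`omegaRect_convexOn_middle.interpolation`).

This file sits above `RectangularExponentBounds.lean` (zero-padding `tensorRank_matMulTensor_mono₃`,
Kronecker submultiplicativity `Blaser2013_rank_matMulTensor_mul_le`, the flattening lower bound
`two_le_of_mem_rectAdmissibleExponents_one_one`, and `omegaRect_one_mid_one : ω(1,p,1) = ω(1,1,p)`),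
which itself imports `RectangularExponent.lean`; hence a sibling `…Proofs` file rather than an
append to the file declaring the fact. Everything here is PROVED; no new definitions, no named facts.

## Proof (the standard one: homogeneity and subadditivity of the exponent, Lotti–Romani 1983, §1)

Work in the last slot `ω(1, 1, q) = inf {β | R(⟨n, n, ⌈n^q⌉⟩) = O(n^β)}`. Let `x, y ≥ 0`, weights
`a, b ≥ 0` with `a + b = 1`, and let `β`, `γ` be admissible for `(1,1,x)`, `(1,1,y)`; then
`R(⟨m, m, ⌈m^x⌉⟩) ≤ C₁ m^β` and `R(⟨m, m, ⌈m^y⌉⟩) ≤ C₂ m^γ` for *all* `m ≥ 1`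
(`exists_bound_of_mem_rectAdmissibleExponents_one_one`). For `n ≥ 1` put `m₁ = ⌈n^a⌉`,
`m₂ = ⌈n^b⌉`: `n ≤ m₁ m₂` and `⌈n^{ax+by}⌉ ≤ ⌈m₁^x⌉ ⌈m₂^y⌉` (`rectDim_convexComb_le`), so padding
(Bläser 2013, Lemma 5.4) and `R(⟨kk', mm', nn'⟩) ≤ R(⟨k,m,n⟩) R(⟨k',m',n'⟩)` (Bläser 2013,
Lemma 5.8) give `R(⟨n, n, ⌈n^{ax+by}⌉⟩) ≤ C₁ m₁^β · C₂ m₂^γ ≤ C₁ C₂ 2^β 2^γ · n^{aβ+bγ}`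
(`mᵢ ≤ 2 n^{a}, 2 n^{b}`; `β, γ ≥ 0` by flattening). Hence `aβ + bγ` is admissible for
`(1, 1, ax + by)` (`convexComb_mem_rectAdmissibleExponents_one_one`); taking infima (the admissible
sets are non-empty and bounded below) gives `ω(1,1,ax+by) ≤ a ω(1,1,x) + b ω(1,1,y)`
(`omegaRect_convexOn_one_one`), and the middle slot follows from `ω(1,k,1) = ω(1,1,k)`
(`omegaRect_convexOn_middle_holds`).

## References

* G. Lotti, F. Romani, *On the asymptotic complexity of rectangular matrix multiplication*,
  Theoret. Comput. Sci. 23 (1983) 171–185, §1 (p. 173), §2 (p. 174). [LottiRomani1983]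
* F. Le Gall, *Faster algorithms for rectangular matrix multiplication*, FOCS 2012, §1 (p. 515;
  arXiv:1204.1111, §1). [LeGall2012]
* M. Bläser, *Fast Matrix Multiplication*, Theory of Computing Graduate Surveys 5 (2013),
  Lemma 5.4, Lemma 5.8, Lemma 7.1. [Blaser2013]
-/

noncomputable section

open Filter Asymptotics

namespace Literature.Computability.AlgebraicComplexity

/-! ## Rectangular dimensions under a convex combination of exponents -/

/-- `⌈n^{ax+by}⌉ ≤ ⌈⌈n^a⌉^x⌉ · ⌈⌈n^b⌉^y⌉` for `n ≥ 1` and `x, y ≥ 0` (any real weights `a, b`):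
`n^{ax+by} = (n^a)^x (n^b)^y ≤ ⌈n^a⌉^x ⌈n^b⌉^y`. [folklore] -/
theorem rectDim_convexComb_le {n : ℕ} (hn : 1 ≤ n) {x y : ℝ} (hx : 0 ≤ x) (hy : 0 ≤ y)
    (a b : ℝ) :
    rectDim n (a * x + b * y) ≤ rectDim (rectDim n a) x * rectDim (rectDim n b) y := by
  have hn0 : (0 : ℝ) < n := by exact_mod_cast hn
  show ⌈(n : ℝ) ^ (a * x + b * y)⌉₊ ≤ _
  refine Nat.ceil_le.2 ?_
  have h1 : ((n : ℝ) ^ a) ^ x ≤ (rectDim (rectDim n a) x : ℝ) :=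
    (Real.rpow_le_rpow (Real.rpow_nonneg hn0.le a) (Nat.le_ceil _) hx).trans (Nat.le_ceil _)
  have h2 : ((n : ℝ) ^ b) ^ y ≤ (rectDim (rectDim n b) y : ℝ) :=
    (Real.rpow_le_rpow (Real.rpow_nonneg hn0.le b) (Nat.le_ceil _) hy).trans (Nat.le_ceil _)
  calc (n : ℝ) ^ (a * x + b * y) = ((n : ℝ) ^ a) ^ x * ((n : ℝ) ^ b) ^ y := by
        rw [Real.rpow_add hn0, Real.rpow_mul hn0.le, Real.rpow_mul hn0.le]
    _ ≤ (rectDim (rectDim n a) x : ℝ) * (rectDim (rectDim n b) y : ℝ) :=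
        mul_le_mul h1 h2 (Real.rpow_nonneg (Real.rpow_nonneg hn0.le b) y) (Nat.cast_nonneg _)
    _ = ((rectDim (rectDim n a) x * rectDim (rectDim n b) y : ℕ) : ℝ) := (Nat.cast_mul _ _).symm

/-! ## Convex combinations of admissible exponents -/

section Convexity

variable (K : Type) [Field K]

/-- An admissible exponent `β` of `(1, 1, q)` bounds the rank for **every** `m ≥ 1`, not only
eventually: `R(⟨m, m, ⌈m^q⌉⟩) ≤ C m^β` for some `C > 0` (finitely many exceptions are absorbed into
the constant, `m^β > 0`). [folklore] -/
theorem exists_bound_of_mem_rectAdmissibleExponents_one_one {q β : ℝ}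
    (hβ : β ∈ rectAdmissibleExponents K 1 1 q) :
    ∃ C : ℝ, 0 < C ∧ ∀ m : ℕ, 1 ≤ m →
      (tensorRank (matMulTensor K m m (rectDim m q)) : ℝ) ≤ C * (m : ℝ) ^ β := by
  obtain ⟨C, hC0, hC⟩ := bound_of_isBigO_nat_atTop hβ
  refine ⟨C, hC0, fun m hm => ?_⟩
  have hm0 : (0 : ℝ) < m := by exact_mod_cast hm
  have h : ‖(tensorRank (matMulTensor K (rectDim m 1) (rectDim m 1) (rectDim m q)) : ℝ)‖ ≤
      C * ‖(m : ℝ) ^ β‖ := hC (Real.rpow_pos_of_pos hm0 β).ne'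
  rwa [Real.norm_of_nonneg (Nat.cast_nonneg _), Real.norm_of_nonneg (Real.rpow_nonneg hm0.le _),
    tensorRank_matMulTensor_congr K (rectDim_one m) (rectDim_one m) rfl] at h

/-- **Convex combinations of admissible exponents are admissible** (the subadditivity-and-homogeneity
step of Lotti–Romani 1983, §1, p. 173, in the format `(1, 1, q)`): if `β` is admissible for
`(1, 1, x)` and `γ` for `(1, 1, y)` (`x, y ≥ 0`), then for weights `a, b ≥ 0`, `a + b = 1`,
`aβ + bγ` is admissible for `(1, 1, ax + by)`. Indeed with `m₁ = ⌈n^a⌉`, `m₂ = ⌈n^b⌉`,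
`R(⟨n, n, ⌈n^{ax+by}⌉⟩) ≤ R(⟨m₁m₂, m₁m₂, ⌈m₁^x⌉⌈m₂^y⌉⟩) ≤ R(⟨m₁, m₁, ⌈m₁^x⌉⟩) R(⟨m₂, m₂, ⌈m₂^y⌉⟩)
 ≤ C₁ m₁^β C₂ m₂^γ ≤ C₁ C₂ 2^β 2^γ n^{aβ+bγ}` (padding, Bläser 2013 Lemma 5.4; Kronecker product,
Lemma 5.8; `β, γ ≥ 0` by flattening, Lemma 7.1). [cite: LottiRomani1983, §1 (p. 173)] -/
theorem convexComb_mem_rectAdmissibleExponents_one_one {x y : ℝ} (hx : 0 ≤ x) (hy : 0 ≤ y)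
    {a b : ℝ} (ha : 0 ≤ a) (hb : 0 ≤ b) (hab : a + b = 1) {β γ : ℝ}
    (hβ : β ∈ rectAdmissibleExponents K 1 1 x) (hγ : γ ∈ rectAdmissibleExponents K 1 1 y) :
    a * β + b * γ ∈ rectAdmissibleExponents K 1 1 (a * x + b * y) := by
  obtain rfl : b = 1 - a := by linarith
  have hβ0 : 0 ≤ β := zero_le_two.trans (two_le_of_mem_rectAdmissibleExponents_one_one K hβ)
  have hγ0 : 0 ≤ γ := zero_le_two.trans (two_le_of_mem_rectAdmissibleExponents_one_one K hγ)
  obtain ⟨C₁, hC₁0, hC₁⟩ := exists_bound_of_mem_rectAdmissibleExponents_one_one K hβ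
  obtain ⟨C₂, hC₂0, hC₂⟩ := exists_bound_of_mem_rectAdmissibleExponents_one_one K hγ
  refine IsBigO.of_bound (C₁ * C₂ * ((2 : ℝ) ^ β * (2 : ℝ) ^ γ)) ?_
  filter_upwards [eventually_ge_atTop 1] with n hn
  have hn0 : (0 : ℝ) < n := by exact_mod_cast hn
  rw [Real.norm_of_nonneg (Nat.cast_nonneg _), Real.norm_of_nonneg (Real.rpow_nonneg hn0.le _),
    tensorRank_matMulTensor_congr K (rectDim_one n) (rectDim_one n) rfl]
  -- `m₁ = ⌈n^a⌉ = rectDim n a`, `m₂ = ⌈n^{1-a}⌉ = rectDim n (1 - a)`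
  have hm₁ : 1 ≤ rectDim n a := one_le_rectDim hn a
  have hm₂ : 1 ≤ rectDim n (1 - a) := one_le_rectDim hn (1 - a)
  -- the rank estimate over `ℕ`: padding, then the Kronecker product
  have hnat : tensorRank (matMulTensor K n n (rectDim n (a * x + (1 - a) * y))) ≤
      tensorRank (matMulTensor K (rectDim n a) (rectDim n a) (rectDim (rectDim n a) x)) *
        tensorRank (matMulTensor K (rectDim n (1 - a)) (rectDim n (1 - a))
          (rectDim (rectDim n (1 - a)) y)) :=
    calc tensorRank (matMulTensor K n n (rectDim n (a * x + (1 - a) * y)))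
        ≤ tensorRank (matMulTensor K (rectDim n a * rectDim n (1 - a))
            (rectDim n a * rectDim n (1 - a))
            (rectDim (rectDim n a) x * rectDim (rectDim n (1 - a)) y)) :=
          tensorRank_matMulTensor_mono₃ K (le_rectDim_mul_rectDim n a)
            (le_rectDim_mul_rectDim n a) (rectDim_convexComb_le hn hx hy a (1 - a))
      _ ≤ _ := Blaser2013_rank_matMulTensor_mul_le K (rectDim n a) (rectDim n a)
          (rectDim (rectDim n a) x) (rectDim n (1 - a)) (rectDim n (1 - a))
          (rectDim (rectDim n (1 - a)) y)
  -- sizes: `m₁ ≤ 2 n^a`, `m₂ ≤ 2 n^{1-a}`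
  have hm₁le : (rectDim n a : ℝ) ≤ 2 * (n : ℝ) ^ a := by
    simpa [max_eq_left ha] using rectDim_le hn a
  have hm₂le : (rectDim n (1 - a) : ℝ) ≤ 2 * (n : ℝ) ^ (1 - a) := by
    simpa [max_eq_left hb] using rectDim_le hn (1 - a)
  have h₁ : (tensorRank (matMulTensor K (rectDim n a) (rectDim n a) (rectDim (rectDim n a) x)) : ℝ)
      ≤ C₁ * (2 * (n : ℝ) ^ a) ^ β :=
    (hC₁ _ hm₁).trans
      (mul_le_mul_of_nonneg_left (Real.rpow_le_rpow (Nat.cast_nonneg _) hm₁le hβ0) hC₁0.le)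
  have h₂ : (tensorRank (matMulTensor K (rectDim n (1 - a)) (rectDim n (1 - a))
      (rectDim (rectDim n (1 - a)) y)) : ℝ) ≤ C₂ * (2 * (n : ℝ) ^ (1 - a)) ^ γ :=
    (hC₂ _ hm₂).trans
      (mul_le_mul_of_nonneg_left (Real.rpow_le_rpow (Nat.cast_nonneg _) hm₂le hγ0) hC₂0.le)
  have hC₁' : 0 ≤ C₁ * (2 * (n : ℝ) ^ a) ^ β :=
    mul_nonneg hC₁0.le (Real.rpow_nonneg (by positivity) _)
  calc (tensorRank (matMulTensor K n n (rectDim n (a * x + (1 - a) * y))) : ℝ)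
      ≤ (tensorRank (matMulTensor K (rectDim n a) (rectDim n a) (rectDim (rectDim n a) x)) : ℝ) *
          (tensorRank (matMulTensor K (rectDim n (1 - a)) (rectDim n (1 - a))
            (rectDim (rectDim n (1 - a)) y)) : ℝ) := by
        exact_mod_cast hnat
    _ ≤ (C₁ * (2 * (n : ℝ) ^ a) ^ β) * (C₂ * (2 * (n : ℝ) ^ (1 - a)) ^ γ) :=
        mul_le_mul h₁ h₂ (Nat.cast_nonneg _) hC₁'
    _ = C₁ * C₂ * ((2 : ℝ) ^ β * (2 : ℝ) ^ γ) * (n : ℝ) ^ (a * β + (1 - a) * γ) := by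
        rw [Real.mul_rpow zero_le_two (Real.rpow_nonneg hn0.le _),
          Real.mul_rpow zero_le_two (Real.rpow_nonneg hn0.le _), ← Real.rpow_mul hn0.le,
          ← Real.rpow_mul hn0.le, Real.rpow_add hn0]
        ring

/-- **Convexity of `q ↦ ω(1, 1, q)` on `[0, ∞)`** (Lotti–Romani 1983, §1–§2: "`f(x) = B(x,1,1)` is a
continuous and convex function"; `B(1,1,x) = B(x,1,1)` by symmetry): for `x, y ≥ 0` and weights
`a, b ≥ 0`, `a + b = 1`, `ω(1,1,ax+by) ≤ a ω(1,1,x) + b ω(1,1,y)` — take admissible `β < ω(1,1,x) + ε`,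
`γ < ω(1,1,y) + ε`, use `convexComb_mem_rectAdmissibleExponents_one_one` and let `ε → 0`.
[cite: LottiRomani1983, §2 (p. 174)] -/
theorem omegaRect_convexOn_one_one : ConvexOn ℝ (Set.Ici (0 : ℝ)) fun q => omegaRect K 1 1 q := by
  refine ⟨convex_Ici 0, fun x hx y hy a b ha hb hab => ?_⟩
  simp only [smul_eq_mul]
  refine le_of_forall_pos_le_add fun ε hε => ?_
  obtain ⟨β, hβ, hβlt⟩ := exists_lt_of_csInf_lt (rectAdmissibleExponents_nonempty K 1 1 x)
    (lt_add_of_pos_right (omegaRect K 1 1 x) hε)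
  obtain ⟨γ, hγ, hγlt⟩ := exists_lt_of_csInf_lt (rectAdmissibleExponents_nonempty K 1 1 y)
    (lt_add_of_pos_right (omegaRect K 1 1 y) hε)
  have hmem := convexComb_mem_rectAdmissibleExponents_one_one K (Set.mem_Ici.1 hx)
    (Set.mem_Ici.1 hy) ha hb hab hβ hγ
  calc omegaRect K 1 1 (a * x + b * y) ≤ a * β + b * γ :=
        csInf_le (rectAdmissibleExponents_one_one_bddBelow K _) hmem
    _ ≤ a * (omegaRect K 1 1 x + ε) + b * (omegaRect K 1 1 y + ε) :=
        add_le_add (mul_le_mul_of_nonneg_left hβlt.le ha) (mul_le_mul_of_nonneg_left hγlt.le hb)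
    _ = a * omegaRect K 1 1 x + b * omegaRect K 1 1 y + ε := by linear_combination ε * hab

/-- **Convexity of `k ↦ ω(1, k, 1)` on `[0, ∞)`** over the field `K` (the middle slot, via
`ω(1, k, 1) = ω(1, 1, k)`, Bläser 2013 Lemma 5.5 / Le Gall 2012 §1). [cite: LottiRomani1983, §2 (p. 174)] -/
theorem omegaRect_convexOn_one_mid_one :
    ConvexOn ℝ (Set.Ici (0 : ℝ)) fun k => omegaRect K 1 k 1 := by
  have e : (fun k : ℝ => omegaRect K 1 k 1) = fun k : ℝ => omegaRect K 1 1 k :=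
    funext fun k => omegaRect_one_mid_one K k
  rw [e]
  exact omegaRect_convexOn_one_one K

end Convexity

/-! ## Discharge of the named fact -/

/-- **Discharge of `omegaRect_convexOn_middle`**: for every field `K`, `k ↦ ω(1, k, 1)` is convex on
`[0, ∞)` — the convexity of the rectangular exponent (Lotti–Romani 1983, §1–§2) that Le Gall 2012,
§1 invokes ("exploit the convexity of the function `ω(1,1,k)`") to interpolate between a bound on
`ω(1,1,k₀)` and a bound on `ω`. [cite: LeGall2012, §1 (convexity of ω(1,1,k))] -/
theorem omegaRect_convexOn_middle_holds : omegaRect_convexOn_middle := by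
  intro K _
  exact omegaRect_convexOn_one_mid_one K

end Literature.Computability.AlgebraicComplexity

end
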